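import Mathlib
import Summits.PneNP.PneNP.Theorems.CnfIdealGenLengthRankDefectRepresentationsTwoFamilyCutDomination
import Summits.PneNP.PneNP.Theorems.CnfIdealGenLengthRankDefectRepresentationsCutLemmaMaxCut
import Summits.PneNP.PneNP.Theorems.CnfIdealGenLengthRankDefectRepresentationsStripCompletion

/-!
# Crux `RankDefectRepresentations` (stmt-PneNP-18923), line `rank-dehn-ladder`: the SINGLE-FAMILY MAX-CUT SCHEME and the
# UNIVERSAL-FRAME linear regime of the 2D max-cut decomposition (lead g12)

Setting of the registered tool stub `stub_coreLinear` / of `DoubleMaxCutDecomposition` (p653152): rows and columns of `D` carry an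
I-colour and a J-colour (`colourI`, `colourJ` of `…TwoFamilyCutDomination`), the entry `(x,y)` is VISIBLE iff both colours differ, and
every double bipartition cut `doubleCut B B′ D` is `≤ c`; wanted is a matrix of rank `O(c)` agreeing with `D` at the visible entries.

THE SINGLE-FAMILY SCHEME (memo `Cruxes/RankDefectRepresentations/Lines/rank-dehn-ladder-g12.md` §1).  Grouped by I-classes ALONE the
instance has exactly the shape of g7's one-family max-cut decomposition (`…CutLemma.exists_blockDiagonal_of_maxCut`, Theorem 2 of
`Lines/rank-dehn-ladder-N1-proof.md`): a block `(i,i′)` with `i ≠ i′` is a ONE-family (J) instance, a block `(i,i)` is entirely invisible.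
For a set `B` of I-colours the I-cut blocks `Q_B = D∘1[(I∈B)×(I∉B)]` and `S_B = D∘1[(I∉B)×(I∈B)]` are J-instances whose J-cut values
`jcut B′ = rank(∘1[(J∈B′)×(J∉B′)]) + rank(∘1[(J∉B′)×(J∈B′)])` are pieces of `doubleCut B B′ D`, and the scheme's currency is
`μ(B) = max_{B′} jcut_{B′}(Q_B) + max_{B′} jcut_{B′}(S_B)`.

THIS FILE (kernel, no new definitions): the UNIVERSAL-FRAME REGIME.  If the set `A` of ALL row I-colours is `μ`-maximal — i.e. some
J-bipartition `B′₀` of the universal block `Q_A` (the columns whose I-colour occurs on no row) dominates `jcut_{B′₁}(Q_B) + jcut_{B′₂}(S_B)`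
for every `B, B′₁, B′₂` — then maximality against `A ∖ {i}` makes the J-max-cut of the row block of class `i` (against the other
I-classes) at most the private dimension of the class-`i` rows in the two genuine max-cut blocks of `Q_A`; private dimensions add up below
the rank (`…CutLemmaMaxCut.sum_rank_sub_erase_le`), so those J-max-cuts SUM to `≤ jcut_{B′₀}(Q_A)`, and completing `Q_A` and each row block
separately by the one-family theorem gives a completion of rank `≤ 8·jcut_{B′₀}(Q_A) ≤ 16 c` (`universalFrame_completion`,
`universalFrame_completion_of_doubleCut`).  This is a third LINEAR regime next to g11's single-type anchor (33c) and transversal anchors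
(160c); it is the base case of the single-family scheme, whose general case (rows outside `B*`) is equivalent to `stub_coreLinear`
(memo §1(b), §2) and stays OPEN.
HONEST FRAMING: elementary linear algebra, a helper (`--supports`) for the crux; the registered stubs are untouched; P ≠ NP is not moved;
F-N2 is a FRONTIER formal rung.
-/

set_option linter.dupNamespace false -- `Summit.PneNP.PneNP.…`: summit = sub-problem name (D-0017)

namespace Summit.PneNP.PneNP.Theorems.CnfIdealGenLengthRankDefectRepresentationsUniversalFrame

open Finset Matrix
open Summit.PneNP.PneNP.Theorems.CnfIdealGenLengthRankDefectRepresentationsTwoFamilyCutDomination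
  (colourI colourJ maskJ doubleCut)
open Summit.PneNP.PneNP.Theorems.CnfIdealGenLengthRankDefectRepresentationsMergeLowerBound (rank_add_le' rank_sum_le')
open Summit.PneNP.PneNP.Theorems.CnfIdealGenLengthRankDefectRepresentationsCutLemma (exists_blockDiagonal_of_maxCut)
open Summit.PneNP.PneNP.Theorems.CnfIdealGenLengthRankDefectRepresentationsCutLemmaMaxCut (sum_rank_sub_erase_le)
open Summit.PneNP.PneNP.Theorems.CnfIdealGenLengthRankDefectRepresentationsStripCompletion (rank_mask_le)

variable {K : Type} [Field K] {n n' : ℕ} {ι ι' : Type} [Fintype ι] [Fintype ι'] [DecidableEq ι] [DecidableEq ι']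

/-- A J-instance given as a masked matrix `M` (rows/columns J-coloured through `row`, `col`) has a completion — a matrix agreeing with
`M` wherever the J-colours differ — of rank at most four times its J-max-cut: g7's one-family max-cut decomposition with the
maximising bipartition chosen here. -/
theorem exists_completion_le_four_jmaxcut (row : ι → Fin n ⊕ Fin n' → Bool) (col : ι' → Fin n ⊕ Fin n' → Bool)
    (M : Matrix ι ι' K) :
    ∃ (B₀ : Finset (Fin n' → Bool)) (L : Matrix ι ι' K),
      (∀ B' : Finset (Fin n' → Bool),
        (Matrix.of fun x y => if colourJ (row x) ∈ B' ∧ colourJ (col y) ∉ B' then M x y else 0).rank +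
          (Matrix.of fun x y => if colourJ (row x) ∉ B' ∧ colourJ (col y) ∈ B' then M x y else 0).rank ≤
        (Matrix.of fun x y => if colourJ (row x) ∈ B₀ ∧ colourJ (col y) ∉ B₀ then M x y else 0).rank +
          (Matrix.of fun x y => if colourJ (row x) ∉ B₀ ∧ colourJ (col y) ∈ B₀ then M x y else 0).rank) ∧
      L.rank ≤ 4 * ((Matrix.of fun x y => if colourJ (row x) ∈ B₀ ∧ colourJ (col y) ∉ B₀ then M x y else 0).rank +
          (Matrix.of fun x y => if colourJ (row x) ∉ B₀ ∧ colourJ (col y) ∈ B₀ then M x y else 0).rank) ∧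
      ∀ x y, colourJ (row x) ≠ colourJ (col y) → L x y = M x y := by
  classical
  obtain ⟨B₀, -, hB₀⟩ := Finset.exists_max_image (univ : Finset (Finset (Fin n' → Bool)))
    (fun B' => (Matrix.of fun x y => if colourJ (row x) ∈ B' ∧ colourJ (col y) ∉ B' then M x y else 0).rank +
      (Matrix.of fun x y => if colourJ (row x) ∉ B' ∧ colourJ (col y) ∈ B' then M x y else 0).rank) univ_nonempty
  have hmax : ∀ B' : Finset (Fin n' → Bool),
      (Matrix.of fun x y => if colourJ (row x) ∈ B' ∧ colourJ (col y) ∉ B' then M x y else 0).rank +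
        (Matrix.of fun x y => if colourJ (row x) ∉ B' ∧ colourJ (col y) ∈ B' then M x y else 0).rank ≤
      (Matrix.of fun x y => if colourJ (row x) ∈ B₀ ∧ colourJ (col y) ∉ B₀ then M x y else 0).rank +
        (Matrix.of fun x y => if colourJ (row x) ∉ B₀ ∧ colourJ (col y) ∈ B₀ then M x y else 0).rank :=
    fun B' => hB₀ B' (mem_univ _)
  obtain ⟨R', hsupp, hrank⟩ :=
    exists_blockDiagonal_of_maxCut (fun x => colourJ (row x)) (fun y => colourJ (col y)) M B₀ hmax
  refine ⟨B₀, M - R', hmax, hrank, ?_⟩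
  intro x y hxy
  simp only [Matrix.sub_apply, hsupp x y hxy, sub_zero]

/-- **UNIVERSAL-FRAME THEOREM (single-family max-cut scheme, base case).**  Let every row of `D` have its I-colour in `A`, so that the
columns with I-colour outside `A` form an I-universal block `Q_A = D∘1[col ∉ A]`.  Suppose `A` is maximal for the single-family currency
`μ`: some J-bipartition `B′₀` of `Q_A` satisfies `jcut_{B′₁}(Q_B) + jcut_{B′₂}(S_B) ≤ jcut_{B′₀}(Q_A)` for all `B, B′₁, B′₂` (stated with
the masks written out; this is `μ(B) ≤ μ(A)` for all `B`, since `S_A = 0`).  Then some matrix of rank `≤ 8·jcut_{B′₀}(Q_A)` agrees with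
`D` at every visible entry.  Proof: maximality against `A ∖ {i}` bounds the J-max-cut of the class-`i` row block by the private
dimension of the class-`i` rows in the two max-cut blocks of `Q_A`; these add up below `jcut_{B′₀}(Q_A)`; complete `Q_A` and the row
blocks separately by the one-family theorem. -/
theorem universalFrame_completion (row : ι → Fin n ⊕ Fin n' → Bool) (col : ι' → Fin n ⊕ Fin n' → Bool)
    (D : Matrix ι ι' K) (A : Finset (Fin n → Bool)) (hA : ∀ x, colourI (row x) ∈ A) (B₀ : Finset (Fin n' → Bool))
    (hmax : ∀ (B : Finset (Fin n → Bool)) (B₁ B₂ : Finset (Fin n' → Bool)),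
      ((Matrix.of fun x y => if colourJ (row x) ∈ B₁ ∧ colourJ (col y) ∉ B₁ then
            (if colourI (row x) ∈ B ∧ colourI (col y) ∉ B then D x y else 0) else 0).rank +
        (Matrix.of fun x y => if colourJ (row x) ∉ B₁ ∧ colourJ (col y) ∈ B₁ then
            (if colourI (row x) ∈ B ∧ colourI (col y) ∉ B then D x y else 0) else 0).rank) +
      ((Matrix.of fun x y => if colourJ (row x) ∈ B₂ ∧ colourJ (col y) ∉ B₂ then
            (if colourI (row x) ∉ B ∧ colourI (col y) ∈ B then D x y else 0) else 0).rank +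
        (Matrix.of fun x y => if colourJ (row x) ∉ B₂ ∧ colourJ (col y) ∈ B₂ then
            (if colourI (row x) ∉ B ∧ colourI (col y) ∈ B then D x y else 0) else 0).rank) ≤
      (Matrix.of fun x y => if colourJ (row x) ∈ B₀ ∧ colourJ (col y) ∉ B₀ then
            (if colourI (row x) ∈ A ∧ colourI (col y) ∉ A then D x y else 0) else 0).rank +
        (Matrix.of fun x y => if colourJ (row x) ∉ B₀ ∧ colourJ (col y) ∈ B₀ then
            (if colourI (row x) ∈ A ∧ colourI (col y) ∉ A then D x y else 0) else 0).rank) :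
    ∃ L : Matrix ι ι' K,
      L.rank ≤ 8 * ((Matrix.of fun x y => if colourJ (row x) ∈ B₀ ∧ colourJ (col y) ∉ B₀ then
            (if colourI (row x) ∈ A ∧ colourI (col y) ∉ A then D x y else 0) else 0).rank +
        (Matrix.of fun x y => if colourJ (row x) ∉ B₀ ∧ colourJ (col y) ∈ B₀ then
            (if colourI (row x) ∈ A ∧ colourI (col y) ∉ A then D x y else 0) else 0).rank) ∧
      ∀ x y, colourI (row x) ≠ colourI (col y) → colourJ (row x) ≠ colourJ (col y) → L x y = D x y := by
  classical
  -- the universal block and the row blocks (as masked matrices)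
  set QA : Matrix ι ι' K := Matrix.of fun x y => if colourI (row x) ∈ A ∧ colourI (col y) ∉ A then D x y else 0 with hQA
  set P : (Fin n → Bool) → Matrix ι ι' K := fun i =>
    Matrix.of fun x y => if colourI (row x) ∉ A.erase i ∧ colourI (col y) ∈ A.erase i then D x y else 0 with hP
  -- the two genuine max-cut blocks of the universal block
  set X₁ : Matrix ι ι' K := Matrix.of fun x y => if colourJ (row x) ∈ B₀ ∧ colourJ (col y) ∉ B₀ then QA x y else 0 with hX₁
  set X₂ : Matrix ι ι' K := Matrix.of fun x y => if colourJ (row x) ∉ B₀ ∧ colourJ (col y) ∈ B₀ then QA x y else 0 with hX₂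
  set m : ℕ := X₁.rank + X₂.rank with hm
  -- row selections of the max-cut blocks
  have sel_all : ∀ X : Matrix ι ι' K, (Matrix.of fun z y => if colourI (row z) ∈ A then X z y else 0) = X := by
    intro X; ext z y; simp [hA z]
  -- Step 1: maximality against `A.erase i` bounds the J-cuts of the row block `P i`.
  have step1 : ∀ i ∈ A, ∀ B' : Finset (Fin n' → Bool),
      (((Matrix.of fun x y => if colourJ (row x) ∈ B' ∧ colourJ (col y) ∉ B' then P i x y else 0).rank +
        (Matrix.of fun x y => if colourJ (row x) ∉ B' ∧ colourJ (col y) ∈ B' then P i x y else 0).rank : ℕ) : ℤ) ≤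
      ((X₁.rank : ℤ) - ((Matrix.of fun z y => if colourI (row z) ∈ A.erase i then X₁ z y else 0).rank : ℤ)) +
      ((X₂.rank : ℤ) - ((Matrix.of fun z y => if colourI (row z) ∈ A.erase i then X₂ z y else 0).rank : ℤ)) := by
    intro i hi B'
    have h := hmax (A.erase i) B₀ B'
    -- the `Q`-part of the cut `A.erase i` at `B₀` dominates the class-`i`-deleted max-cut blocks of `Q_A`
    have d1 : (Matrix.of fun z y => if colourI (row z) ∈ A.erase i then X₁ z y else 0).rank ≤
        (Matrix.of fun x y => if colourJ (row x) ∈ B₀ ∧ colourJ (col y) ∉ B₀ then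
            (if colourI (row x) ∈ A.erase i ∧ colourI (col y) ∉ A.erase i then D x y else 0) else 0).rank := by
      have e : (Matrix.of fun z y => if colourI (row z) ∈ A.erase i then X₁ z y else 0) =
          Matrix.of fun x y => if True ∧ colourI (col y) ∉ A then
            (Matrix.of fun x y => if colourJ (row x) ∈ B₀ ∧ colourJ (col y) ∉ B₀ then
              (if colourI (row x) ∈ A.erase i ∧ colourI (col y) ∉ A.erase i then D x y else 0) else 0) x y else 0 := by
        ext x y
        simp only [hX₁, hQA, Matrix.of_apply, true_and]
        by_cases h1 : colourI (col y) ∈ A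
        · have h1' : ¬ (colourI (col y) ∉ A) := fun h => h h1
          simp [h1, hA x]
        · have h2 : colourI (col y) ∉ A.erase i := fun h => h1 (Finset.mem_of_mem_erase h)
          by_cases h3 : colourI (row x) ∈ A.erase i <;> simp [h1, h2, h3, hA x]
      rw [e]; exact rank_mask_le _ _ _
    have d2 : (Matrix.of fun z y => if colourI (row z) ∈ A.erase i then X₂ z y else 0).rank ≤
        (Matrix.of fun x y => if colourJ (row x) ∉ B₀ ∧ colourJ (col y) ∈ B₀ then
            (if colourI (row x) ∈ A.erase i ∧ colourI (col y) ∉ A.erase i then D x y else 0) else 0).rank := by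
      have e : (Matrix.of fun z y => if colourI (row z) ∈ A.erase i then X₂ z y else 0) =
          Matrix.of fun x y => if True ∧ colourI (col y) ∉ A then
            (Matrix.of fun x y => if colourJ (row x) ∉ B₀ ∧ colourJ (col y) ∈ B₀ then
              (if colourI (row x) ∈ A.erase i ∧ colourI (col y) ∉ A.erase i then D x y else 0) else 0) x y else 0 := by
        ext x y
        simp only [hX₂, hQA, Matrix.of_apply, true_and]
        by_cases h1 : colourI (col y) ∈ A
        · have h1' : ¬ (colourI (col y) ∉ A) := fun h => h h1
          simp [h1, hA x]
        · have h2 : colourI (col y) ∉ A.erase i := fun h => h1 (Finset.mem_of_mem_erase h)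
          by_cases h3 : colourI (row x) ∈ A.erase i <;> simp [h1, h2, h3, hA x]
      rw [e]; exact rank_mask_le _ _ _
    have hm' : (Matrix.of fun x y => if colourJ (row x) ∈ B₀ ∧ colourJ (col y) ∉ B₀ then
            (if colourI (row x) ∈ A ∧ colourI (col y) ∉ A then D x y else 0) else 0).rank +
        (Matrix.of fun x y => if colourJ (row x) ∉ B₀ ∧ colourJ (col y) ∈ B₀ then
            (if colourI (row x) ∈ A ∧ colourI (col y) ∉ A then D x y else 0) else 0).rank = X₁.rank + X₂.rank := by
      simp only [hX₁, hX₂, hQA, Matrix.of_apply]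
    have hPi : ∀ B'' : Finset (Fin n' → Bool),
        (Matrix.of fun x y => if colourJ (row x) ∈ B'' ∧ colourJ (col y) ∉ B'' then P i x y else 0).rank +
          (Matrix.of fun x y => if colourJ (row x) ∉ B'' ∧ colourJ (col y) ∈ B'' then P i x y else 0).rank =
        (Matrix.of fun x y => if colourJ (row x) ∈ B'' ∧ colourJ (col y) ∉ B'' then
            (if colourI (row x) ∉ A.erase i ∧ colourI (col y) ∈ A.erase i then D x y else 0) else 0).rank +
        (Matrix.of fun x y => if colourJ (row x) ∉ B'' ∧ colourJ (col y) ∈ B'' then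
            (if colourI (row x) ∉ A.erase i ∧ colourI (col y) ∈ A.erase i then D x y else 0) else 0).rank := by
      intro B''; simp only [hP, Matrix.of_apply]
    rw [hPi B']
    rw [hm'] at h
    push_cast
    omega
  -- Step 2: the row blocks' J-max-cuts add up below `m`.
  -- choose a J-max-cut bipartition and a completion for every row block, and for the universal block
  have hblocks : ∀ i : Fin n → Bool, ∃ (Bi : Finset (Fin n' → Bool)) (L : Matrix ι ι' K),
      (∀ B' : Finset (Fin n' → Bool),
        (Matrix.of fun x y => if colourJ (row x) ∈ B' ∧ colourJ (col y) ∉ B' then P i x y else 0).rank +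
          (Matrix.of fun x y => if colourJ (row x) ∉ B' ∧ colourJ (col y) ∈ B' then P i x y else 0).rank ≤
        (Matrix.of fun x y => if colourJ (row x) ∈ Bi ∧ colourJ (col y) ∉ Bi then P i x y else 0).rank +
          (Matrix.of fun x y => if colourJ (row x) ∉ Bi ∧ colourJ (col y) ∈ Bi then P i x y else 0).rank) ∧
      L.rank ≤ 4 * ((Matrix.of fun x y => if colourJ (row x) ∈ Bi ∧ colourJ (col y) ∉ Bi then P i x y else 0).rank +
          (Matrix.of fun x y => if colourJ (row x) ∉ Bi ∧ colourJ (col y) ∈ Bi then P i x y else 0).rank) ∧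
      ∀ x y, colourJ (row x) ≠ colourJ (col y) → L x y = P i x y :=
    fun i => exists_completion_le_four_jmaxcut row col (P i)
  choose Bi Li hBimax hLirank hLi using hblocks
  set cuti : (Fin n → Bool) → ℕ := fun i =>
    (Matrix.of fun x y => if colourJ (row x) ∈ Bi i ∧ colourJ (col y) ∉ Bi i then P i x y else 0).rank +
      (Matrix.of fun x y => if colourJ (row x) ∉ Bi i ∧ colourJ (col y) ∈ Bi i then P i x y else 0).rank with hcuti
  have hsum : ((∑ i ∈ A, cuti i : ℕ) : ℤ) ≤ (m : ℤ) := by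
    have e1 := sum_rank_sub_erase_le (K := K) (fun z => colourI (row z)) X₁ A A
    have e2 := sum_rank_sub_erase_le (K := K) (fun z => colourI (row z)) X₂ A A
    have z1 : (Matrix.of fun z y => if colourI (row z) ∈ A \ A then X₁ z y else 0) = 0 := by
      ext z y; simp
    have z2 : (Matrix.of fun z y => if colourI (row z) ∈ A \ A then X₂ z y else 0) = 0 := by
      ext z y; simp
    rw [z1, Matrix.rank_zero] at e1
    rw [z2, Matrix.rank_zero] at e2
    rw [sel_all X₁] at e1
    rw [sel_all X₂] at e2
    have hle : ∀ i ∈ A, ((cuti i : ℕ) : ℤ) ≤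
        ((X₁.rank : ℤ) - ((Matrix.of fun z y => if colourI (row z) ∈ A.erase i then X₁ z y else 0).rank : ℤ)) +
        ((X₂.rank : ℤ) - ((Matrix.of fun z y => if colourI (row z) ∈ A.erase i then X₂ z y else 0).rank : ℤ)) :=
      fun i hi => step1 i hi (Bi i)
    push_cast
    calc (∑ i ∈ A, (cuti i : ℤ))
        ≤ ∑ i ∈ A, (((X₁.rank : ℤ) - ((Matrix.of fun z y => if colourI (row z) ∈ A.erase i then X₁ z y else 0).rank : ℤ)) +
          ((X₂.rank : ℤ) - ((Matrix.of fun z y => if colourI (row z) ∈ A.erase i then X₂ z y else 0).rank : ℤ))) :=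
          Finset.sum_le_sum hle
      _ = (∑ i ∈ A, ((X₁.rank : ℤ) - ((Matrix.of fun z y => if colourI (row z) ∈ A.erase i then X₁ z y else 0).rank : ℤ))) +
          ∑ i ∈ A, ((X₂.rank : ℤ) - ((Matrix.of fun z y => if colourI (row z) ∈ A.erase i then X₂ z y else 0).rank : ℤ)) :=
          Finset.sum_add_distrib
      _ ≤ (X₁.rank : ℤ) + (X₂.rank : ℤ) := by
          push_cast at e1 e2
          simp only [add_zero] at e1 e2
          linarith
      _ = (m : ℤ) := by rw [hm]; push_cast; ring
  have hsumN : ∑ i ∈ A, cuti i ≤ m := by exact_mod_cast hsum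
  -- Step 3: the universal block is completed at its own max cut `B₀` (which `hmax` makes a J-max-cut of `Q_A`).
  have hQAmax : ∀ B' : Finset (Fin n' → Bool),
      (Matrix.of fun x y => if colourJ (row x) ∈ B' ∧ colourJ (col y) ∉ B' then QA x y else 0).rank +
        (Matrix.of fun x y => if colourJ (row x) ∉ B' ∧ colourJ (col y) ∈ B' then QA x y else 0).rank ≤
      (Matrix.of fun x y => if colourJ (row x) ∈ B₀ ∧ colourJ (col y) ∉ B₀ then QA x y else 0).rank +
        (Matrix.of fun x y => if colourJ (row x) ∉ B₀ ∧ colourJ (col y) ∈ B₀ then QA x y else 0).rank := by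
    intro B'
    have h := hmax A B' B₀
    exact le_trans (Nat.le_add_right _ _) h
  obtain ⟨R₀, hR₀supp, hR₀rank⟩ :=
    exists_blockDiagonal_of_maxCut (fun x => colourJ (row x)) (fun y => colourJ (col y)) QA B₀ hQAmax
  have hR₀rank' : (QA - R₀).rank ≤ 4 * m := by
    have h := hR₀rank
    rw [← hX₁, ← hX₂] at h
    rw [hm]
    exact h
  -- Step 4: assemble.
  refine ⟨(QA - R₀) + ∑ i ∈ A, Li i, ?_, ?_⟩
  · -- rank
    have hfinal : m = (Matrix.of fun x y => if colourJ (row x) ∈ B₀ ∧ colourJ (col y) ∉ B₀ then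
            (if colourI (row x) ∈ A ∧ colourI (col y) ∉ A then D x y else 0) else 0).rank +
        (Matrix.of fun x y => if colourJ (row x) ∉ B₀ ∧ colourJ (col y) ∈ B₀ then
            (if colourI (row x) ∈ A ∧ colourI (col y) ∉ A then D x y else 0) else 0).rank := by
      simp only [hm, hX₁, hX₂, hQA, Matrix.of_apply]
    rw [← hfinal]
    calc ((QA - R₀) + ∑ i ∈ A, Li i).rank
        ≤ (QA - R₀).rank + (∑ i ∈ A, Li i).rank := rank_add_le' _ _
      _ ≤ 4 * m + ∑ i ∈ A, (Li i).rank := Nat.add_le_add hR₀rank' (rank_sum_le' A Li)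
      _ ≤ 4 * m + ∑ i ∈ A, 4 * cuti i := Nat.add_le_add_left (Finset.sum_le_sum fun i _ => hLirank i) _
      _ = 4 * m + 4 * ∑ i ∈ A, cuti i := by rw [Finset.mul_sum]
      _ ≤ 4 * m + 4 * m := Nat.add_le_add_left (Nat.mul_le_mul_left 4 hsumN) _
      _ = 8 * m := by ring
  · -- agreement at visible entries
    intro x y hI hJ
    have hsum_apply : (∑ i ∈ A, Li i) x y = ∑ i ∈ A, Li i x y := by
      simp [Matrix.sum_apply]
    rw [Matrix.add_apply, Matrix.sub_apply, hR₀supp x y hJ, sub_zero, hsum_apply]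
    have hLi' : ∀ i ∈ A, Li i x y = P i x y := fun i _ => hLi i x y hJ
    rw [Finset.sum_congr rfl hLi']
    -- exactly the term `i = colourI (row x)` survives
    rw [Finset.sum_eq_single (colourI (row x))]
    · simp only [hQA, hP, Matrix.of_apply, Finset.mem_erase, ne_eq, not_true_eq_false, false_and, not_false_eq_true,
        true_and, hA x]
      by_cases h1 : colourI (col y) ∈ A
      · have : ¬ colourI (col y) = colourI (row x) := fun h => hI h.symm
        simp [h1, this]
      · simp [h1]
    · intro i _ hne
      have hmem : colourI (row x) ∈ A.erase i := Finset.mem_erase.mpr ⟨fun h => hne h.symm, hA x⟩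
      have hnot : ¬ (colourI (row x) ∉ A.erase i ∧ colourI (col y) ∈ A.erase i) := fun h => h.1 hmem
      simp only [hP, Matrix.of_apply, if_neg hnot]
    · intro h; exact absurd (hA x) h

/-- **Corollary (the regime in the crux's vocabulary).**  If all double bipartition cuts of `D` are `≤ c`, all row I-colours lie in
`A`, and `A` is maximal for the single-family currency in the sense of `universalFrame_completion`, then some matrix of rank `≤ 16 c`
agrees with `D` at every visible entry (the two max-cut blocks of the universal block are maskings of the first summand of
`doubleCut A B′₀ D`, so `jcut_{B′₀}(Q_A) ≤ 2c`). -/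
theorem universalFrame_completion_of_doubleCut (row : ι → Fin n ⊕ Fin n' → Bool) (col : ι' → Fin n ⊕ Fin n' → Bool)
    (D : Matrix ι ι' K) (c : ℕ) (hc : ∀ B B', doubleCut row col B B' D ≤ c)
    (A : Finset (Fin n → Bool)) (hA : ∀ x, colourI (row x) ∈ A) (B₀ : Finset (Fin n' → Bool))
    (hmax : ∀ (B : Finset (Fin n → Bool)) (B₁ B₂ : Finset (Fin n' → Bool)),
      ((Matrix.of fun x y => if colourJ (row x) ∈ B₁ ∧ colourJ (col y) ∉ B₁ then
            (if colourI (row x) ∈ B ∧ colourI (col y) ∉ B then D x y else 0) else 0).rank +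
        (Matrix.of fun x y => if colourJ (row x) ∉ B₁ ∧ colourJ (col y) ∈ B₁ then
            (if colourI (row x) ∈ B ∧ colourI (col y) ∉ B then D x y else 0) else 0).rank) +
      ((Matrix.of fun x y => if colourJ (row x) ∈ B₂ ∧ colourJ (col y) ∉ B₂ then
            (if colourI (row x) ∉ B ∧ colourI (col y) ∈ B then D x y else 0) else 0).rank +
        (Matrix.of fun x y => if colourJ (row x) ∉ B₂ ∧ colourJ (col y) ∈ B₂ then
            (if colourI (row x) ∉ B ∧ colourI (col y) ∈ B then D x y else 0) else 0).rank) ≤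
      (Matrix.of fun x y => if colourJ (row x) ∈ B₀ ∧ colourJ (col y) ∉ B₀ then
            (if colourI (row x) ∈ A ∧ colourI (col y) ∉ A then D x y else 0) else 0).rank +
        (Matrix.of fun x y => if colourJ (row x) ∉ B₀ ∧ colourJ (col y) ∈ B₀ then
            (if colourI (row x) ∈ A ∧ colourI (col y) ∉ A then D x y else 0) else 0).rank) :
    ∃ L : Matrix ι ι' K, L.rank ≤ 16 * c ∧
      ∀ x y, colourI (row x) ≠ colourI (col y) → colourJ (row x) ≠ colourJ (col y) → L x y = D x y := by
  classical
  obtain ⟨L, hL, hagree⟩ := universalFrame_completion row col D A hA B₀ hmax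
  refine ⟨L, hL.trans ?_, hagree⟩
  -- the first summand of `doubleCut A B₀ D`
  set M₁ : Matrix ι ι' K :=
    Matrix.of fun x y => if colourI (row x) ∈ A ∧ colourI (col y) ∉ A then maskJ row col B₀ D x y else 0 with hM₁
  have hM₁c : M₁.rank ≤ c := by
    have h := hc A B₀
    unfold doubleCut at h
    exact le_trans (Nat.le_add_right _ _) h
  have e1 : (Matrix.of fun x y => if colourJ (row x) ∈ B₀ ∧ colourJ (col y) ∉ B₀ then
        (if colourI (row x) ∈ A ∧ colourI (col y) ∉ A then D x y else 0) else 0) =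
      Matrix.of fun x y => if colourJ (row x) ∈ B₀ ∧ colourI (col y) ∉ A then M₁ x y else 0 := by
    ext x y
    simp only [hM₁, maskJ, Matrix.of_apply]
    by_cases h1 : colourJ (row x) ∈ B₀ <;> by_cases h2 : colourJ (col y) ∈ B₀ <;>
      by_cases h3 : colourI (col y) ∈ A <;> simp [h1, h2, h3, hA x]
  have e2 : (Matrix.of fun x y => if colourJ (row x) ∉ B₀ ∧ colourJ (col y) ∈ B₀ then
        (if colourI (row x) ∈ A ∧ colourI (col y) ∉ A then D x y else 0) else 0) =
      Matrix.of fun x y => if colourJ (row x) ∉ B₀ ∧ colourI (col y) ∉ A then M₁ x y else 0 := by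
    ext x y
    simp only [hM₁, maskJ, Matrix.of_apply]
    by_cases h1 : colourJ (row x) ∈ B₀ <;> by_cases h2 : colourJ (col y) ∈ B₀ <;>
      by_cases h3 : colourI (col y) ∈ A <;> simp [h1, h2, h3, hA x]
  rw [e1, e2]
  have r1 := rank_mask_le (fun x => colourJ (row x) ∈ B₀) (fun y => colourI (col y) ∉ A) M₁
  have r2 := rank_mask_le (fun x => colourJ (row x) ∉ B₀) (fun y => colourI (col y) ∉ A) M₁
  have r1' : (Matrix.of fun x y => if colourJ (row x) ∈ B₀ ∧ colourI (col y) ∉ A then M₁ x y else 0).rank ≤ c :=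
    r1.trans hM₁c
  have r2' : (Matrix.of fun x y => if colourJ (row x) ∉ B₀ ∧ colourI (col y) ∉ A then M₁ x y else 0).rank ≤ c :=
    r2.trans hM₁c
  omega

end Summit.PneNP.PneNP.Theorems.CnfIdealGenLengthRankDefectRepresentationsUniversalFrame
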